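import Mathlib

/-!
# `Balaban1983to89.B11Smallness` — [Balaban1985Variational]: the printed smallness / constant arithmetic of
# Sects. B, C, D, F that the tree did not yet carry — (33), (37), (40), (57), (62), (103), (113)–(114), p. 296,
# (145), (146), (165)–(168); v2: + the p. 292 «gathering» of the termwise bounds (86)–(96) into Prop. 4's (97) —
# kernel-checked as real-number inequalities; v3 (r08 gen 40, 2026-08-22): DOCSTRING-ONLY — the p. 286 sentence quoted
# in `ineq57` re-typed verbatim from the page render `…-p010-x4.png` («for example we take 9C₂B₀ε₃ ≦ 1/2, i.e.
# ε₃ ≦ (18C₂B₀)⁻¹»; v1/v2 carried «= ½», the text layer's OCR reading — referee ref-3 gen 55 micro-FYI); every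
# declaration byte-identical

statement-level skeleton of published theorems with citation tags; proofs where landed; nothing here is a claim about the Yang–Mills mass gap

CITATION HEADER (lean-in-tree rule 2026-08-18).  T. Bałaban, *The variational problem and background fields in
renormalization group method for lattice gauge theories*, Commun. Math. Phys. **102**, 277–309 (1985),
doi:10.1007/bf01229381 [Balaban1985Variational] (cell paper B11; held `paper:balaban1985-cmp102-variational-background`,
journal page = PDF page + 276).  Quotations from the page renders `run/shared/lean/pub/pub-balaban/b2b-balaban-ref1/pages/
1985-cmp102-variational-background/…-p008-x2.png` (p. 284: (37)–(40)), `…-p025-x2.png` (p. 301: (145)–(146)),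
`…-p028-x2.png` (p. 304: (163)–(168)) READ AS IMAGES by this seat (lit-balaban reader/typer r08, 2026-08-20), and from
the render-verified transcript `run/shared/lean/pub/pub-balaban/b2b-balaban-b11/transcript.md` for pp. 282–283 ((32)–(33)),
pp. 286–287 ((57), (62)), p. 293 ((103)–(104)), p. 294 ((113)–(114)), p. 296.

WHAT THIS FILE IS.  Each theorem below is ONE displayed chain of elementary inequalities between the paper's constants
(ε₀, ε₁, ε₂, ε₃, C₁, B₀, B₁, B₃, C₂, C₄, d, L, M, R₁M₁, …), transcribed symbol by symbol and proved by real
arithmetic; the analytic content each chain is applied to (the plaquette functions V^{(3)}, V′₀, V₄ of (29)–(39), the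
averages Ū of (145)–(146), the field A of (165)–(168)) is NOT modelled — the norms enter as real variables with the
bounds the print assumes at that point ((32): `L^jη|A| < ε₂`, `|(DA)(p)| < 2ε₂(L^jη)^{-2}`; `|A|(∂p) ≤ 4|A|`;
`η ≤ L^jη`, i.e. `L^{-j} ≤ 1`).  Companion rows of the existing tree: `B11.ineq118_121`, `B11.ineq122`, `B11.ineq169`,
`B11.ineq173`, `B11.eps4_existence_bound`, `B11.halving_reaches_B3eps1`, `B11B3.ineq161_le_quarter_B3`.  Located
reading recorded, not asserted: in (146) the cell's census (pub-balaban GAPS C-B11-F1) notes that the premise of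
(1.65) [6] on □̃ is (2) with `L²ε₀η²`, so the first member should read `11d²L²ε₀`; the theorem `ineq146_iff` states
the PRINTED chain's arithmetic content (`11d² + 1 < dL²M`) and `ineq146_corrected_iff` the located variant
(`11d²L² + 1 < dL²M`), both as pure equivalences.  Unit `lit-balaban-r08` (skeleton rows r08.23, .26, .28, .35, .36,
.49, .52, .57, .68, .76, .77 of `HOME/lit-balaban-r08/SKELETON-r08.md`).  Mathlib only.
-/

namespace Literature.MathematicalPhysics.QuantumFieldTheory.Balaban1983to89.B11Smallness

/-! ## Sect. B, p. 282–284 -/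

/-- p. 283 [PDF 7], before (33): *«This implies e^{η|A|(∂p)} < e^{4ε₂} < 2»* under (32) *«L^jη|A|, (L^jη)²|∇A| < ε₂
on Ω_j»* and *«let us assume for simplicity that 32ε₂ ≤ 1»*; here with `S = |A|(∂p) ≤ 4|A|`, `a = |A| < ε₂(L^jη)^{-1}`,
`t = L^jη ≥ η`. [cite: Balaban1985Variational, (32)–(33) pp.282–283] -/
theorem exp_eta_contour_lt_two (a S η t ε₂ : ℝ) (ht : 0 < t) (hη0 : 0 ≤ η) (hηt : η ≤ t) (hS0 : 0 ≤ S)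
    (hS : S ≤ 4 * a) (ha : a < ε₂ / t) (h32 : 32 * ε₂ ≤ 1) :
    Real.exp (η * S) ≤ Real.exp (4 * ε₂) ∧ Real.exp (4 * ε₂) < 2 := by
  have hε₂ : 0 < ε₂ := by
    have : 0 < ε₂ / t := lt_of_le_of_lt (by nlinarith) ha
    exact (div_pos_iff_of_pos_right ht).1 this
  constructor
  · refine Real.exp_le_exp.2 ?_
    have h1 : η * S ≤ η * (4 * a) := mul_le_mul_of_nonneg_left hS hη0
    have h2 : η * (4 * a) ≤ t * (4 * (ε₂ / t)) := by
      have ha' : 4 * a ≤ 4 * (ε₂ / t) := by linarith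
      have hapos : 0 ≤ 4 * (ε₂ / t) := by positivity
      calc η * (4 * a) ≤ η * (4 * (ε₂ / t)) := mul_le_mul_of_nonneg_left ha' hη0
        _ ≤ t * (4 * (ε₂ / t)) := mul_le_mul_of_nonneg_right hηt hapos
    have h3 : t * (4 * (ε₂ / t)) = 4 * ε₂ := by field_simp
    linarith
  · have h4 : |4 * ε₂| = 4 * ε₂ := abs_of_nonneg (by linarith)
    have hx : |4 * ε₂| ≤ 1 := by rw [h4]; linarith
    have hb := Real.abs_exp_sub_one_le hx
    rw [h4] at hb
    have : Real.exp (4 * ε₂) - 1 ≤ 2 * (4 * ε₂) := le_trans (le_abs_self _) hb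
    linarith

/-- **(33)** p. 283 [PDF 7]: *«|V₄(A,∂p)| ≤ (2/4!)(|A|(∂p))⁴ ≤ 2⁵|A|⁴ < 2⁵ε₂⁴(L^jη)^{-4}. (33)»* — the arithmetic, for a
quantity `v ≤ (1/4!)(|A|(∂p))⁴e^{η|A|(∂p)}` ((31)) with `e^{η|A|(∂p)} < 2`, `|A|(∂p) ≤ 4|A|`, `0 ≤ |A| < ε₂(L^jη)^{-1}`.
[cite: Balaban1985Variational, (31)–(33) pp.282–283] -/
theorem ineq33 (v a S e t ε₂ : ℝ) (ha0 : 0 ≤ a) (hS0 : 0 ≤ S) (hS : S ≤ 4 * a) (ha : a < ε₂ / t)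
    (he : e < 2) (hv : v ≤ (1 / 24) * S ^ 4 * e) :
    v ≤ (2 / 24) * S ^ 4 ∧ (2 / 24) * S ^ 4 ≤ 2 ^ 5 * a ^ 4 ∧ 2 ^ 5 * a ^ 4 < 2 ^ 5 * ε₂ ^ 4 / t ^ 4 := by
  have hS4 : 0 ≤ S ^ 4 := by positivity
  refine ⟨?_, ?_, ?_⟩
  · have : (1 / 24) * S ^ 4 * e ≤ (1 / 24) * S ^ 4 * 2 :=
      mul_le_mul_of_nonneg_left he.le (by positivity)
    linarith
  · have : S ^ 4 ≤ (4 * a) ^ 4 := pow_le_pow_left₀ hS0 hS 4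
    nlinarith
  · have hu : a ^ 4 < (ε₂ / t) ^ 4 := pow_lt_pow_left₀ ha ha0 (by norm_num)
    rw [div_pow] at hu
    have : 2 ^ 5 * a ^ 4 < 2 ^ 5 * (ε₂ ^ 4 / t ^ 4) := by linarith
    simpa [mul_div_assoc] using this

/-- **(37)** p. 284 [PDF 8]: *«|V^{(3)}(A,∂p)| ≤ ½|(DA)(p)|(|A|(∂p))² + ½η(|A|(∂p))³C₁B₃ε₁(L^jη)^{-2} ≤ 8|A|²|(DA)(p)| +
32η|A|³C₁B₃ε₁(L^jη)^{-2} < 8ε₂²(L^jη)^{-2}|(DA)(p)| + 32L^{-j}C₁B₃ε₁ε₂³(L^jη)^{-4} < 16ε₂³(1 + 2C₁B₃ε₁)(L^jη)^{-4},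
p ∈ Ω_j. (37)»* — the arithmetic, with `S = |A|(∂p) ≤ 4a`, `a = |A| < ε₂t^{-1}`, `δ = |(DA)(p)| < 2ε₂t^{-2}` ((32)),
`K = C₁B₃ε₁ ≥ 0`, `t = L^jη`, `L^{-j} = η/t ≤ 1`; the two middle members are typed with `≤` (they may coincide in
degenerate cases), the printed end-to-end strict inequality is the last conjunct. [cite: Balaban1985Variational, (37) p.284] -/
theorem ineq37 (a S δ η t K ε₂ : ℝ) (ht : 0 < t) (hη0 : 0 ≤ η) (hηt : η ≤ t) (ha0 : 0 ≤ a) (hS0 : 0 ≤ S)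
    (hS : S ≤ 4 * a) (ha : a < ε₂ / t) (hδ0 : 0 ≤ δ) (hδ : δ < 2 * ε₂ / t ^ 2) (hK : 0 ≤ K) :
    (1 / 2) * δ * S ^ 2 + (1 / 2) * η * S ^ 3 * K / t ^ 2 ≤ 8 * a ^ 2 * δ + 32 * η * a ^ 3 * K / t ^ 2 ∧
    8 * a ^ 2 * δ + 32 * η * a ^ 3 * K / t ^ 2 ≤ 8 * ε₂ ^ 2 / t ^ 2 * δ + 32 * (η / t) * K * ε₂ ^ 3 / t ^ 4 ∧
    8 * ε₂ ^ 2 / t ^ 2 * δ + 32 * (η / t) * K * ε₂ ^ 3 / t ^ 4 ≤ 16 * ε₂ ^ 3 * (1 + 2 * K) / t ^ 4 ∧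
    8 * a ^ 2 * δ + 32 * η * a ^ 3 * K / t ^ 2 < 16 * ε₂ ^ 3 * (1 + 2 * K) / t ^ 4 := by
  have ht2 : 0 < t ^ 2 := by positivity
  have ht4 : 0 < t ^ 4 := by positivity
  have hu0 : 0 < ε₂ / t := lt_of_le_of_lt ha0 ha
  have hε₂ : 0 < ε₂ := (div_pos_iff_of_pos_right ht).1 hu0
  have ha2 : a ^ 2 ≤ (ε₂ / t) ^ 2 := pow_le_pow_left₀ ha0 ha.le 2
  have ha3 : a ^ 3 ≤ (ε₂ / t) ^ 3 := pow_le_pow_left₀ ha0 ha.le 3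
  have hS2 : S ^ 2 ≤ (4 * a) ^ 2 := pow_le_pow_left₀ hS0 hS 2
  have hS3 : S ^ 3 ≤ (4 * a) ^ 3 := pow_le_pow_left₀ hS0 hS 3
  -- (i)
  have h1 : (1 / 2) * δ * S ^ 2 ≤ 8 * a ^ 2 * δ := by nlinarith
  have h2 : (1 / 2) * η * S ^ 3 * K / t ^ 2 ≤ 32 * η * a ^ 3 * K / t ^ 2 := by
    refine div_le_div_of_nonneg_right ?_ ht2.le
    have : η * S ^ 3 * K ≤ η * (4 * a) ^ 3 * K := by
      have := mul_le_mul_of_nonneg_left hS3 hη0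
      exact mul_le_mul_of_nonneg_right this hK
    nlinarith
  -- (ii)
  have h3 : 8 * a ^ 2 * δ ≤ 8 * ε₂ ^ 2 / t ^ 2 * δ := by
    rw [div_pow] at ha2
    have := mul_le_mul_of_nonneg_right ha2 hδ0
    calc 8 * a ^ 2 * δ = 8 * (a ^ 2 * δ) := by ring
      _ ≤ 8 * (ε₂ ^ 2 / t ^ 2 * δ) := by linarith
      _ = 8 * ε₂ ^ 2 / t ^ 2 * δ := by ring
  have h4 : 32 * η * a ^ 3 * K / t ^ 2 ≤ 32 * (η / t) * K * ε₂ ^ 3 / t ^ 4 := by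
    have e : 32 * (η / t) * K * ε₂ ^ 3 / t ^ 4 = 32 * η * (ε₂ / t) ^ 3 * K / t ^ 2 := by
      field_simp
      try ring
    rw [e]
    refine div_le_div_of_nonneg_right ?_ ht2.le
    have := mul_le_mul_of_nonneg_left ha3 (by positivity : 0 ≤ 32 * η)
    have := mul_le_mul_of_nonneg_right this hK
    nlinarith
  -- (iii)
  have h5 : 8 * ε₂ ^ 2 / t ^ 2 * δ ≤ 8 * ε₂ ^ 2 / t ^ 2 * (2 * ε₂ / t ^ 2) :=
    mul_le_mul_of_nonneg_left hδ.le (by positivity)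
  have h5' : 8 * ε₂ ^ 2 / t ^ 2 * δ < 8 * ε₂ ^ 2 / t ^ 2 * (2 * ε₂ / t ^ 2) :=
    mul_lt_mul_of_pos_left hδ (by positivity)
  have e5 : 8 * ε₂ ^ 2 / t ^ 2 * (2 * ε₂ / t ^ 2) = 16 * ε₂ ^ 3 / t ^ 4 := by
    field_simp
    try ring
  have h6 : 32 * (η / t) * K * ε₂ ^ 3 / t ^ 4 ≤ 32 * K * ε₂ ^ 3 / t ^ 4 := by
    refine div_le_div_of_nonneg_right ?_ ht4.le
    have hηt' : η / t ≤ 1 := (div_le_one ht).2 hηt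
    have hpos : 0 ≤ 32 * K * ε₂ ^ 3 := by positivity
    nlinarith
  have e7 : 16 * ε₂ ^ 3 / t ^ 4 + 32 * K * ε₂ ^ 3 / t ^ 4 = 16 * ε₂ ^ 3 * (1 + 2 * K) / t ^ 4 := by
    field_simp
    try ring
  refine ⟨by linarith, by linarith, by linarith, by linarith⟩

/-- **(38) ⇒ the hidden factor**; **(40)** p. 284 [PDF 8]: *«|V′₀(A,∂p)| ≤ (|A|(∂p))³ηC₁B₃ε₁(L^jη)^{-2} + (2/4!)(|A|(∂p))⁴
≤ 64|A|³(L^{-j}C₁B₃ε₁(L^jη)^{-1} + ⅓|A|) ≤ 64|A|³(C₁B₃ε₁ + ε₂)(L^jη)^{-1} < 64ε₂³(C₁B₃ε₁ + ε₂)(L^jη)^{-4}, p ∈ Ω_j.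
(40) Here we have used only the first bound (32) on the field A alone.»* — the arithmetic, same dictionary as `ineq37`
(`S ≤ 4a`, `0 ≤ a < ε₂/t`, `K = C₁B₃ε₁ ≥ 0`, `L^{-j} = η/t ≤ 1`). [cite: Balaban1985Variational, (40) p.284] -/
theorem ineq40 (a S η t K ε₂ : ℝ) (ht : 0 < t) (hη0 : 0 ≤ η) (hηt : η ≤ t) (ha0 : 0 ≤ a) (hS0 : 0 ≤ S)
    (hS : S ≤ 4 * a) (ha : a < ε₂ / t) (hK : 0 ≤ K) :
    S ^ 3 * η * K / t ^ 2 + (2 / 24) * S ^ 4 ≤ 64 * a ^ 3 * ((η / t) * K / t + (1 / 3) * a) ∧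
    64 * a ^ 3 * ((η / t) * K / t + (1 / 3) * a) ≤ 64 * a ^ 3 * (K + ε₂) / t ∧
    64 * a ^ 3 * (K + ε₂) / t < 64 * ε₂ ^ 3 * (K + ε₂) / t ^ 4 := by
  have hu0 : 0 < ε₂ / t := lt_of_le_of_lt ha0 ha
  have hε₂ : 0 < ε₂ := (div_pos_iff_of_pos_right ht).1 hu0
  have hS3 : S ^ 3 ≤ (4 * a) ^ 3 := pow_le_pow_left₀ hS0 hS 3
  have hS4 : S ^ 4 ≤ (4 * a) ^ 4 := pow_le_pow_left₀ hS0 hS 4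
  have ha3lt : a ^ 3 < (ε₂ / t) ^ 3 := pow_lt_pow_left₀ ha ha0 (by norm_num)
  refine ⟨?_, ?_, ?_⟩
  · have e : 64 * a ^ 3 * ((η / t) * K / t + (1 / 3) * a) = (4 * a) ^ 3 * η * K / t ^ 2 + (64 / 3) * a ^ 4 := by
      field_simp
      try ring
    rw [e]
    have h1 : S ^ 3 * η * K / t ^ 2 ≤ (4 * a) ^ 3 * η * K / t ^ 2 := by
      refine div_le_div_of_nonneg_right ?_ (by positivity)
      have := mul_le_mul_of_nonneg_right (mul_le_mul_of_nonneg_right hS3 hη0) hK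
      linarith
    nlinarith
  · have hηt' : η / t ≤ 1 := (div_le_one ht).2 hηt
    have h1 : (η / t) * K / t ≤ K / t := by
      refine div_le_div_of_nonneg_right ?_ ht.le
      nlinarith
    have h2 : (1 / 3) * a ≤ ε₂ / t := by linarith
    have h3 : (η / t) * K / t + (1 / 3) * a ≤ (K + ε₂) / t := by rw [add_div]; linarith
    have := mul_le_mul_of_nonneg_left h3 (by positivity : 0 ≤ 64 * a ^ 3)
    simpa [mul_div_assoc] using this
  · have hKε : 0 < K + ε₂ := by linarith
    have : 64 * a ^ 3 * (K + ε₂) < 64 * (ε₂ / t) ^ 3 * (K + ε₂) := by nlinarith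
    have := div_lt_div_of_pos_right this ht
    have e : 64 * (ε₂ / t) ^ 3 * (K + ε₂) / t = 64 * ε₂ ^ 3 * (K + ε₂) / t ^ 4 := by
      field_simp
      try ring
    linarith [e]

/-! ## Sect. C, pp. 286–287 -/

/-- **(57)** p. 286 [PDF 10]: *«|A| ≤ |A′| + B₀(L^jη)^{-1}4C₂|A′|²_{(−1)} < (ε₃ + 4C₂B₀ε₃²)(L^jη)^{-1} < 2ε₃(L^jη)^{-1} on
Ω_j. (57)»* — last member: `ε₃ + 4C₂B₀ε₃² < 2ε₃` under the standing `18C₂B₀ε₃ ≤ 1` (p. 286, after (54): *«Hence the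
transformation is contractive if 9C₂B₀ε₃ < 1; for example we take 9C₂B₀ε₃ ≦ 1/2, i.e. ε₃ ≦ (18C₂B₀)⁻¹.»*), `ε₃ > 0`
(no sign assumption on `C₂B₀` needed). [cite: Balaban1985Variational, (57) p.286] -/
theorem ineq57 (C₂ B₀ ε₃ : ℝ) (hε₃ : 0 < ε₃) (h18 : 18 * C₂ * B₀ * ε₃ ≤ 1) :
    ε₃ + 4 * C₂ * B₀ * ε₃ ^ 2 < 2 * ε₃ := by
  nlinarith

/-- **(62)** p. 287 [PDF 11]: *«exactly one solution of Eq. (59) satisfying L^jη|A′|, (L^jη)²|∇A′| < ε₂ + 16C₂B₀ε₂² <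
2ε₂ ≤ ½ε₃ on Ω_j, (62)»* — the two last members under `ε₂ ≤ ¼ε₃` and `18C₂B₀ε₃ ≤ 1`, `ε₂ > 0`, `C₂B₀ ≥ 0`.
[cite: Balaban1985Variational, (62) p.287] -/
theorem ineq62 (C₂ B₀ ε₂ ε₃ : ℝ) (hC : 0 ≤ C₂ * B₀) (hε₂ : 0 < ε₂) (hε : ε₂ ≤ ε₃ / 4)
    (h18 : 18 * C₂ * B₀ * ε₃ ≤ 1) :
    ε₂ + 16 * C₂ * B₀ * ε₂ ^ 2 < 2 * ε₂ ∧ 2 * ε₂ ≤ ε₃ / 2 := by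
  constructor
  · have h1 : C₂ * B₀ * (16 * ε₂) ≤ C₂ * B₀ * (4 * ε₃) := mul_le_mul_of_nonneg_left (by linarith) hC
    have h2 : 16 * C₂ * B₀ * ε₂ < 1 := by nlinarith
    have h3 : 16 * C₂ * B₀ * ε₂ ^ 2 < ε₂ := by nlinarith
    linarith
  · linarith

/-! ## Sect. D, pp. 293–294, 296 -/

/-- **(103)** p. 293 [PDF 17]: *«|H₁B| < B₀2dLC₁ε₁(L^jη)^{-1}, |∇H₁B| < B₀2dLC₁ε₁(L^jη)^{-2} on Ω_j, 2dLB₀C₁ε₁ < B₁C₁ε₁ < ε₃,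
(103)»* — the constant chain with `B₁ = 5dLB₀` (p. 296; [6] Prop. 3) and `ε₃ = 4B₁(ε₀ + C₁ε₁)` ((114)), for
`dLB₀ > 0`, `C₁ε₁ > 0`, `ε₀ ≥ 0`. [cite: Balaban1985Variational, (103) p.293] -/
theorem ineq103 (d L B₀ C₁ ε₀ ε₁ : ℝ) (hdLB : 0 < d * L * B₀) (hCε : 0 < C₁ * ε₁) (hε₀ : 0 ≤ ε₀) :
    2 * d * L * B₀ * C₁ * ε₁ < (5 * d * L * B₀) * C₁ * ε₁ ∧
    (5 * d * L * B₀) * C₁ * ε₁ < 4 * (5 * d * L * B₀) * (ε₀ + C₁ * ε₁) := by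
  constructor <;> nlinarith

/-- **(113) from (114)** p. 294 [PDF 18]: *«B₃ε₁ ≤ ε₀, B₁(ε₀ + C₁ε₁) ≤ ε₂, ε₂ ≤ ¼ε₃, (113) ε₃ sufficiently small. We get
best restrictions on ε₀, ε₁ (i.e. largest constants a₀, a₁) if we take ε₂ = B₁(ε₀ + C₁ε₁), ε₃ = 4ε₂ = 4B₁(ε₀ + C₁ε₁).
(114)»* — the choice (114) satisfies the last two members of (113). [cite: Balaban1985Variational, (113)–(114) p.294] -/
theorem ineq113_of_114 (B₁ C₁ ε₀ ε₁ ε₂ ε₃ : ℝ) (h₂ : ε₂ = B₁ * (ε₀ + C₁ * ε₁)) (h₃ : ε₃ = 4 * ε₂) :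
    B₁ * (ε₀ + C₁ * ε₁) ≤ ε₂ ∧ ε₂ ≤ ε₃ / 4 := by
  constructor <;> linarith

/-- p. 296 [PDF 20]: *«To get simpler formulations let us take ε₂ = B₁ε₀ + 5dLB₀C₁B₃ε₁ (we have B₁ = 5dLB₀), then
the second condition above [2B₀C₁B₃ε₁ ≤ 8ε₂] is satisfied automatically.»* — for nonnegative constants with
`dL ≥ 1/20`-free slack: `2B₀C₁B₃ε₁ ≤ 8(B₁ε₀ + 5dLB₀C₁B₃ε₁)` whenever `B₁ε₀ ≥ 0`, `B₀C₁B₃ε₁ ≥ 0`, `dL ≥ 1`.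
[cite: Balaban1985Variational, p.296] -/
theorem second_condition_automatic (d L B₀ B₁ C₁ B₃ ε₀ ε₁ : ℝ) (h1 : 0 ≤ B₁ * ε₀) (h2 : 0 ≤ B₀ * C₁ * B₃ * ε₁)
    (hdL : 1 ≤ d * L) :
    2 * B₀ * C₁ * B₃ * ε₁ ≤ 8 * (B₁ * ε₀ + 5 * d * L * B₀ * C₁ * B₃ * ε₁) := by
  nlinarith

/-! ## Sect. F, pp. 301–304 -/

/-- **(145)** p. 301 [PDF 25]: *«|Ū′ᵏ_k(x,x′) − 1| < |x − y|2L²ε₀ ≤ 4d(M + R₁M₁)L²ε₀ ≤ 8dL²Mε₀ (145) for ⟨x,x′⟩ ⊂ □̃^{(k)},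
y is a point of □^{(k)}»* — the two last members, for `|x − y| ≤ 2d(M + R₁M₁)` (x ∈ □̃ of size (2M + 4R₁M₁), y ∈ □)
and `R₁M₁ ≤ M` (p. 300: *«In both cases M ≥ R₁M₁»*), `d, L²ε₀ ≥ 0`. [cite: Balaban1985Variational, (145) p.301] -/
theorem ineq145 (dist d M R₁M₁ L ε₀ : ℝ) (hd : 0 ≤ d) (hε : 0 ≤ L ^ 2 * ε₀) (hdist : dist ≤ 2 * d * (M + R₁M₁))
    (hM : R₁M₁ ≤ M) :
    dist * (2 * L ^ 2 * ε₀) ≤ 4 * d * (M + R₁M₁) * L ^ 2 * ε₀ ∧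
    4 * d * (M + R₁M₁) * L ^ 2 * ε₀ ≤ 8 * d * L ^ 2 * M * ε₀ := by
  constructor
  · nlinarith
  · have : d * (M + R₁M₁) ≤ d * (2 * M) := mul_le_mul_of_nonneg_left (by linarith) hd
    nlinarith

/-- **(146)** p. 301 [PDF 25], AS PRINTED: *«The inequality (1.65) [6] implies further |Ū′ʲ_k(x,x′) − 1| < 11d²ε₀ + 8dL²Mε₀
< 9dL²Mε₀ − ε₀, for ⟨x,x′⟩ ⊂ □̃^{(j)}, j = 0,1,…,k. (146)»* — its last member holds iff `11d² + 1 < dL²M` (ε₀ > 0).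
[cite: Balaban1985Variational, (146) p.301] -/
theorem ineq146_iff (d L M ε₀ : ℝ) (hε₀ : 0 < ε₀) :
    11 * d ^ 2 * ε₀ + 8 * d * L ^ 2 * M * ε₀ < 9 * d * L ^ 2 * M * ε₀ - ε₀ ↔ 11 * d ^ 2 + 1 < d * L ^ 2 * M := by
  constructor
  · intro h; nlinarith
  · intro h; nlinarith

/-- (146) in the located reading of the audit cell pub-balaban (GAPS C-B11-F1: the premise of (1.65) [6] on □̃ is (2) with
`L²ε₀η²`, p. 300, so the first member carries `11d²L²ε₀`): `11d²L²ε₀ + 8dL²Mε₀ < 9dL²Mε₀ − ε₀ ↔ 11d²L² + 1 < dL²M` —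
recorded as arithmetic only; which member is the paper's is NOT asserted here. [cite: Balaban1985Variational, (146) p.301] -/
theorem ineq146_corrected_iff (d L M ε₀ : ℝ) (hε₀ : 0 < ε₀) :
    11 * d ^ 2 * L ^ 2 * ε₀ + 8 * d * L ^ 2 * M * ε₀ < 9 * d * L ^ 2 * M * ε₀ - ε₀ ↔
      11 * d ^ 2 * L ^ 2 + 1 < d * L ^ 2 * M := by
  constructor
  · intro h; nlinarith
  · intro h; nlinarith

/-- **(165), second line** p. 304 [PDF 28]: *«… + B₀C₄(36dL²B₁Mε₀)² + B₀4C₂(36dL²B₁Mε₀)² ≤ ¼M_Δ max{B₃ε₁, ½ε₀} +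
B₀(C₄ + 4C₂)(36dL²B₁R₁M₁)²(M′ε₀)², (165) where M′ = 1 in the first case, …, and M′ = (R₁M₁)^{-1}M in the second
case»* — with `M = M′R₁M₁` the two quadratic terms combine exactly. [cite: Balaban1985Variational, (165) p.304] -/
theorem ineq165_quadratic_terms (d L B₀ B₁ C₂ C₄ M M' R₁M₁ ε₀ : ℝ) (hM : M = M' * R₁M₁) :
    B₀ * C₄ * (36 * d * L ^ 2 * B₁ * M * ε₀) ^ 2 + B₀ * 4 * C₂ * (36 * d * L ^ 2 * B₁ * M * ε₀) ^ 2 =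
      B₀ * (C₄ + 4 * C₂) * (36 * d * L ^ 2 * B₁ * R₁M₁) ^ 2 * (M' * ε₀) ^ 2 := by
  subst hM; ring

/-- **(166) ⇒ (167)** p. 304 [PDF 28]: *«We take a largest absolute number a₅ such that M′ε₀ ≤ a₅ implies all the previous
restrictions on ε₀, and such that B₀(C₄ + 4C₂)(36dL²B₁R₁M₁)²a₅ ≤ ⅛. (166) If M′ε₀ ≤ a₅, then we get |A|, |∇^ηA|,
|∂^{η*}∂^ηA|, |Δ^ηA| < ¼M_Δ max{B₃ε₁, ½ε₀} + ⅛M′ε₀ on Δ. (167)»* — the step `K(M′ε₀)² ≤ ⅛M′ε₀` for `K a₅ ≤ ⅛`,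
`0 ≤ M′ε₀ ≤ a₅`, `K ≥ 0` (K = B₀(C₄ + 4C₂)(36dL²B₁R₁M₁)²). [cite: Balaban1985Variational, (166)–(167) p.304] -/
theorem ineq167_of_166 (K a₅ x : ℝ) (hK : 0 ≤ K) (h166 : K * a₅ ≤ 1 / 8) (hx0 : 0 ≤ x) (hx : x ≤ a₅) :
    K * x ^ 2 ≤ (1 / 8) * x := by
  have : K * x ≤ K * a₅ := mul_le_mul_of_nonneg_left hx hK
  nlinarith

/-- p. 304 [PDF 28], first case of (167): *«We take Δ = Δ₀, hence M_Δ = 1, M′ = 1, and we have this inequality with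
ε′ = ½max{B₃ε₁, ½ε₀} on the right-hand side»* — indeed `¼max{B₃ε₁, ½ε₀} + ⅛ε₀ ≤ ½max{B₃ε₁, ½ε₀}`.
[cite: Balaban1985Variational, (167) p.304] -/
theorem ineq167_first_case (B₃ε₁ ε₀ : ℝ) :
    (1 / 4) * max B₃ε₁ (ε₀ / 2) + (1 / 8) * ε₀ ≤ (1 / 2) * max B₃ε₁ (ε₀ / 2) := by
  have : ε₀ / 2 ≤ max B₃ε₁ (ε₀ / 2) := le_max_right _ _
  linarith

/-- **(168)** p. 304 [PDF 28]: *«This and the inequality (1.54) of [6] imply |D^{η*}_{U₁}∂U₁| < ε′ + 86dε′² < 2ε′ on Δ₀ (168)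
for ε′ small»* — the last member holds iff `86dε′ < 1` (ε′ > 0); and `2ε′ = max{B₃ε₁, ½ε₀}` for
`ε′ = ½max{B₃ε₁, ½ε₀}`, the radius in *«U′_k satisfies (2) on Δ₀ with max{B₃ε₁, ½ε₀} instead of ε₀»*.
[cite: Balaban1985Variational, (168) p.304] -/
theorem ineq168_iff (d ε' : ℝ) (hε' : 0 < ε') : ε' + 86 * d * ε' ^ 2 < 2 * ε' ↔ 86 * d * ε' < 1 := by
  constructor
  · intro h; nlinarith
  · intro h; nlinarith

/-- `2ε′ = max{B₃ε₁, ½ε₀}` for `ε′ = ½max{B₃ε₁, ½ε₀}` (p. 304). [cite: Balaban1985Variational, (168) p.304] -/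
theorem two_eps'_eq (B₃ε₁ ε₀ : ℝ) : 2 * ((1 / 2) * max B₃ε₁ (ε₀ / 2)) = max B₃ε₁ (ε₀ / 2) := by ring

/-! ## v2 append: Sect. D, p. 292 — gathering the termwise bounds into Proposition 4 -/

/-- **p. 292 [PDF 16]: «Gathering together all these estimates we get the following proposition»** (Prop. 4, (97):
`|((δ/δA′)V)(A′)| < C₄ε₃²(L^jη)^{-3}` with *«The constants a₃, C₄ depend on d and L only»*).  The five termwise bounds
printed on pp. 291–292, all on Ω_j with the factor `(L^jη)^{-3}` stripped: (86) `≤ O(1)ε₁ε₃²` (the ⟨HD₃, J⟩-term),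
(88) `O(1)ε₃²` (the ⟨A′, Δ_πHD(A′)⟩-term), (89) `O(1)ε₃³` (the third term), (90) `O(1)ε₃²(ε₁ + ε₃)` (the V′₀-term),
(91)–(96) `O(1)|∇A′||A′| ≤ O(1)ε₃²` (the commutator term, by (77)).  The arithmetic: for nonnegative O(1)-constants
`K₁ … K₅`, `ε₁ ≤ c` (the standing smallness of ε₁) and `ε₃ ≤ 1`, the sum is `≤ C₄ε₃²` with the (d, L)-only
constant `C₄ := K₁c + K₂ + K₃ + K₄(c + 1) + K₅`. [cite: Balaban1985Variational, Prop. 4 (97) pp.291–293] -/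
theorem prop4_gathering (K₁ K₂ K₃ K₄ K₅ c ε₁ ε₃ : ℝ) (hK₁ : 0 ≤ K₁) (hK₃ : 0 ≤ K₃) (hK₄ : 0 ≤ K₄)
    (hε₁c : ε₁ ≤ c) (hε₃1 : ε₃ ≤ 1) :
    K₁ * ε₁ * ε₃ ^ 2 + K₂ * ε₃ ^ 2 + K₃ * ε₃ ^ 3 + K₄ * ε₃ ^ 2 * (ε₁ + ε₃) + K₅ * ε₃ ^ 2 ≤
      (K₁ * c + K₂ + K₃ + K₄ * (c + 1) + K₅) * ε₃ ^ 2 := by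
  have h2 : 0 ≤ ε₃ ^ 2 := by positivity
  have h1 : K₁ * ε₁ * ε₃ ^ 2 ≤ K₁ * c * ε₃ ^ 2 := by
    have := mul_le_mul_of_nonneg_left hε₁c hK₁
    nlinarith
  have h3 : K₃ * ε₃ ^ 3 ≤ K₃ * ε₃ ^ 2 := by
    have : ε₃ ^ 3 ≤ ε₃ ^ 2 := by nlinarith
    nlinarith
  have h4 : K₄ * ε₃ ^ 2 * (ε₁ + ε₃) ≤ K₄ * (c + 1) * ε₃ ^ 2 := by
    have : ε₁ + ε₃ ≤ c + 1 := by linarith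
    have := mul_le_mul_of_nonneg_left this (mul_nonneg hK₄ h2)
    nlinarith
  nlinarith

end Literature.MathematicalPhysics.QuantumFieldTheory.Balaban1983to89.B11Smallness
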